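import Mathlib.Tactic
import HarnessLib
import Summits.CriticalPhenomena.PercolationContinuityZ3.Theorems.PercNearOneGluingNoHeavyLowerTailKnQuestion8UnifThreeConvex

/-!
# Kozma–Nitzan's Question 8 at three relays — assembly of the universal k = 3 step (RC-G3) (gen 32)

Support file (`--supports stmt-CriticalPhenomena-4575`, closed crux; independent mathematics on Kozma–Nitzan's Question 8,
arXiv:2401.12397 §5.5 p. 36), prover `prim-ineq-gen-6` (gen 32).  No definitions, no named facts, no sorries; standard axioms.
Memo `run/shared/lean/prim/prim-ineq-gen-6/PROOF-RCG3-G32.md` §1–§3.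

Upper layers of the proof of (RC-G3): the un-normalised form of the core (♦) (`k3_diamond_un`, from `k3_diamond` by the substitution
`v̂ = v_F/P_F`, `m̂ = m_F/P_F` and multiplication by `P_F³`), the observer-lens bound LEMMA (ṽ) (`k3_vt_bound`), the prefix part of the
depth-1 excess (`k3_n3prefix`), and (♣) un-normalised (`k3_club_un`: `A ≤ 1`, `s ≤ 1`, `M₁ ≥ C`, `P_F ≤ 1`).  The final assembly is
`k3_rcg3` in `…UnifThreeStep`.
[cite: KozmaNitzan2024, Question 8 (§5.5 p. 36)]
-/

namespace Summit.CriticalPhenomena.PercolationContinuityZ3.Theorems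

namespace PocketCert

/-- **(♦) un-normalised.**  With `P_F = u_F+v_F+m_F > 0`, `X = v_F+m_F`, `ν = (1−c)(P_F − σu_F) + cσv_F` (`= (1−c)m̃ + σv_F`),
`p = c(P_F − σv_F) + aν` (`= u+v+m` of `T₂`), `λ′₂ = (1+λ)Cc − 1 ≥ 0`, `λ′₂m_F ≤ v_F` (from `v_F ≥ δ₃m_F`, `δ₃ > λ′₂`) and `K = ¾ − λ(1−λ)a`:
`a²·P_F·(ν·λ′₂·X + λ(1−C)cσ·v_F·P_F) ≤ c·v_F·p·(K·P_F + C·a·ν)`.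
[cite: KozmaNitzan2024, Question 8 (§5.5 p. 36)] -/
theorem k3_diamond_un (lam a c C sig uF vF mF : ℝ) (hl0 : 0 < lam) (hl1 : lam < 1) (ha0 : 0 ≤ a) (ha1 : a ≤ 1)
    (hc0 : 0 < c) (hc1 : c ≤ 1) (hC1 : C ≤ 1) (hW : 1 ≤ (1 + lam) * C * c) (hs0 : 0 ≤ sig) (hs1 : sig ≤ 1)
    (hu : 0 ≤ uF) (hv : 0 ≤ vF) (hm : 0 ≤ mF) (hPF : 0 < uF + vF + mF)
    (hcross : ((1 + lam) * C * c - 1) * mF ≤ vF) :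
    a ^ 2 * (uF + vF + mF) * (((1 - c) * ((uF + vF + mF) - sig * uF) + c * sig * vF) * ((1 + lam) * C * c - 1) * (vF + mF)
        + lam * (1 - C) * c * sig * vF * (uF + vF + mF))
      ≤ c * vF * (c * ((uF + vF + mF) - sig * vF) + a * ((1 - c) * ((uF + vF + mF) - sig * uF) + c * sig * vF))
          * ((3 / 4 - lam * (1 - lam) * a) * (uF + vF + mF) + C * a * ((1 - c) * ((uF + vF + mF) - sig * uF) + c * sig * vF)) := by
  set PF := uF + vF + mF with hPFdef
  have hPF0 : PF ≠ 0 := ne_of_gt hPF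
  have hvh0 : 0 ≤ vF / PF := div_nonneg hv hPF.le
  have hmh0 : 0 ≤ mF / PF := div_nonneg hm hPF.le
  have hvm : vF / PF + mF / PF ≤ 1 := by
    rw [← add_div, div_le_one hPF]; rw [hPFdef]; linarith
  have hcr : ((1 + lam) * C * c - 1) * (mF / PF) ≤ vF / PF := by
    rw [← mul_div_assoc]; exact div_le_div_of_nonneg_right hcross hPF.le
  have h := k3_diamond lam a c C sig (vF / PF) (mF / PF) hl0 hl1 ha0 ha1 hc0 hc1 hC1 hW hs0 hs1 hvh0 hmh0 hvm hcr
  -- clear denominators: both sides times PF³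
  have eL : PF ^ 3 * (a ^ 2 * (((1 - c) * (1 - sig * (1 - vF / PF - mF / PF)) + c * sig * (vF / PF)) * ((1 + lam) * C * c - 1)
        * (vF / PF + mF / PF) + lam * (1 - C) * c * sig * (vF / PF)))
      = a ^ 2 * PF * (((1 - c) * (PF - sig * uF) + c * sig * vF) * ((1 + lam) * C * c - 1) * (vF + mF)
        + lam * (1 - C) * c * sig * vF * PF) := by
    field_simp
    rw [hPFdef]; ring
  have eR : PF ^ 3 * (c * (vF / PF) * (c * (1 - sig * (vF / PF)) + a * ((1 - c) * (1 - sig * (1 - vF / PF - mF / PF)) + c * sig * (vF / PF)))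
        * (3 / 4 - lam * (1 - lam) * a + C * a * ((1 - c) * (1 - sig * (1 - vF / PF - mF / PF)) + c * sig * (vF / PF))))
      = c * vF * (c * (PF - sig * vF) + a * ((1 - c) * (PF - sig * uF) + c * sig * vF))
          * ((3 / 4 - lam * (1 - lam) * a) * PF + C * a * ((1 - c) * (PF - sig * uF) + c * sig * vF)) := by
    field_simp
    rw [hPFdef]; ring
  have hP3 : 0 ≤ PF ^ 3 := by positivity
  have := mul_le_mul_of_nonneg_left h hP3
  rw [eL, eR] at this
  exact this

/-- **LEMMA (ṽ)** (observer-lens bound, PROOF-RCG3 §2), polynomial form: with `v = a((1−c)m̃ + σv_F)`, `q ≥ a·c·m̃` (i.e. `q ≥ m`),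
`m̃ ≥ σ·m_F`, `M₁ ≥ A`:  `v₁·(m_F+v_F) ≤ p₀·((1−Cc)m_F + v_F)` where `v₁ = A((1−C)q + sv)`, `p₀ = M₁q + sCu + sAv`.
[cite: KozmaNitzan2024, Question 8 (§5.5 p. 36)] -/
theorem k3_vt_bound (A C s u a c sig mt vF mF q M₁ : ℝ) (hA0 : 0 ≤ A) (hC0 : 0 ≤ C) (hC1 : C ≤ 1) (hMA : A ≤ M₁)
    (hs0 : 0 ≤ s) (hs1 : s ≤ 1) (hu : 0 ≤ u) (ha0 : 0 ≤ a) (hc0 : 0 ≤ c) (hc1 : c ≤ 1)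
    (hsig0 : 0 ≤ sig) (hvF : 0 ≤ vF) (hmF : 0 ≤ mF) (hmt0 : 0 ≤ mt) (hmt : sig * mF ≤ mt) (hq : a * c * mt ≤ q) :
    A * ((1 - C) * q + s * (a * ((1 - c) * mt + sig * vF))) * (mF + vF)
      ≤ (M₁ * q + s * C * u + s * A * (a * ((1 - c) * mt + sig * vF))) * ((1 - C * c) * mF + vF) := by
  set v := a * ((1 - c) * mt + sig * vF) with hv
  have hv0 : 0 ≤ v := by rw [hv]; have : 0 ≤ (1 - c) * mt := mul_nonneg (by linarith) hmt0; positivity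
  have hq0 : 0 ≤ q := le_trans (by positivity) hq
  have hX : 0 ≤ (1 - C * c) * mF + vF := by
    have : C * c ≤ 1 := by
      have := mul_le_mul hC1 hc1 hc0 (by norm_num : (0:ℝ) ≤ 1)
      linarith
    nlinarith [mul_nonneg (sub_nonneg.mpr this) hmF]
  -- p₀ ≥ A(q + s v)
  have hp0 : A * (q + s * v) ≤ M₁ * q + s * C * u + s * A * v := by
    have : A * q ≤ M₁ * q := mul_le_mul_of_nonneg_right hMA hq0
    have : 0 ≤ s * C * u := by positivity
    nlinarith
  -- (q + sv)((1−Cc)m_F + v_F) − ((1−C)q + sv)(m_F + v_F) = C[q m_F (1−c) + q v_F − s v c m_F] ≥ 0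
  have key : (q + s * v) * ((1 - C * c) * mF + vF) - ((1 - C) * q + s * v) * (mF + vF)
      = C * (q * mF * (1 - c) + q * vF - s * v * c * mF) := by ring
  have hbr : 0 ≤ q * mF * (1 - c) + q * vF - s * v * c * mF := by
    -- s v c m_F ≤ a c m̃ (m_F(1−c) + v_F)·… : use v ≤ a((1−c)m̃ + σ v_F), q ≥ a c m̃, m̃ ≥ σ m_F, s ≤ 1
    have e1 : s * v * c * mF ≤ v * c * mF := by
      have : 0 ≤ v * c * mF := by positivity
      nlinarith
    have e2 : v * c * mF = a * c * mt * (mF * (1 - c)) + a * c * mF * (sig * vF) := by rw [hv]; ring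
    have e3 : a * c * mF * (sig * vF) ≤ a * c * mt * vF := by
      have : a * c * (sig * mF) * vF ≤ a * c * mt * vF :=
        mul_le_mul_of_nonneg_right (mul_le_mul_of_nonneg_left hmt (by positivity)) hvF
      linarith [this]
    have e4 : a * c * mt * (mF * (1 - c)) ≤ q * (mF * (1 - c)) :=
      mul_le_mul_of_nonneg_right hq (mul_nonneg hmF (by linarith))
    have e5 : a * c * mt * vF ≤ q * vF := mul_le_mul_of_nonneg_right hq hvF
    nlinarith
  have hmid : ((1 - C) * q + s * v) * (mF + vF) ≤ (q + s * v) * ((1 - C * c) * mF + vF) := by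
    nlinarith [mul_nonneg hC0 hbr]
  calc A * ((1 - C) * q + s * v) * (mF + vF)
      = A * (((1 - C) * q + s * v) * (mF + vF)) := by ring
    _ ≤ A * ((q + s * v) * ((1 - C * c) * mF + vF)) := mul_le_mul_of_nonneg_left hmid hA0
    _ = (A * (q + s * v)) * ((1 - C * c) * mF + vF) := by ring
    _ ≤ (M₁ * q + s * C * u + s * A * v) * ((1 - C * c) * mF + vF) := mul_le_mul_of_nonneg_right hp0 hX

/-- **Prefix part of the depth-1 excess (PROOF-RCG3 §3(a))**: with `(1+λ)Cc ≥ 1`, `A ≤ 1`, `C ≤ 1`, `q ≥ acm̃`: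
`s·a·(1−c)·m̃·(A−C) ≤ (1−C)·λ·A·q`  (the class-`{b₂}` part of `N3` is paid by its share of the L-kill `LL′`).
[cite: KozmaNitzan2024, Question 8 (§5.5 p. 36)] -/
theorem k3_n3prefix (lam A C s a c mt q : ℝ) (hl0 : 0 < lam) (hA0 : 0 ≤ A) (hA1 : A ≤ 1) (hC0 : 0 ≤ C) (hC1 : C ≤ 1)
    (hW : 1 ≤ (1 + lam) * C * c) (hs0 : 0 ≤ s) (hs1 : s ≤ 1) (ha0 : 0 ≤ a) (hc0 : 0 ≤ c) (hc1 : c ≤ 1)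
    (hmt0 : 0 ≤ mt) (hq : a * c * mt ≤ q) :
    s * a * (1 - c) * mt * (A - C) ≤ (1 - C) * lam * A * q := by
  rcases le_or_gt A C with hAC | hCA
  · have h1 : s * a * (1 - c) * mt * (A - C) ≤ 0 := by
      have : 0 ≤ s * a * (1 - c) * mt := by
        have : 0 ≤ 1 - c := by linarith
        positivity
      exact mul_nonpos_of_nonneg_of_nonpos this (by linarith)
    have h2 : 0 ≤ (1 - C) * lam * A * q := by
      have : 0 ≤ 1 - C := by linarith
      have : 0 ≤ q := le_trans (by positivity) hq
      positivity
    linarith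
  · -- core: (1−c)(A−C) ≤ (1−C) λ A c, from (1−c) ≤ c((1+λ)C − 1) and linearity in A
    have hcore : (1 - c) * (A - C) ≤ (1 - C) * lam * A * c := by
      have g1 : 1 - c ≤ c * ((1 + lam) * C - 1) := by nlinarith
      have g2 : (1 - c) * (A - C) ≤ c * ((1 + lam) * C - 1) * (A - C) :=
        mul_le_mul_of_nonneg_right g1 (by linarith)
      have g3 : ((1 + lam) * C - 1) * (A - C) ≤ (1 - C) * lam * A := by
        -- affine in A; values at A = C and A = 1 are ≥ 0
        have e : (1 - C) * ((1 - C) * lam * A - ((1 + lam) * C - 1) * (A - C))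
            = (1 - A) * ((1 - C) * lam * C) + (A - C) * ((1 - C) ^ 2 * (1 + lam)) := by ring
        have p1 : 0 ≤ (1 - A) * ((1 - C) * lam * C) :=
          mul_nonneg (by linarith) (mul_nonneg (mul_nonneg (by linarith) hl0.le) hC0)
        have p2 : 0 ≤ (A - C) * ((1 - C) ^ 2 * (1 + lam)) :=
          mul_nonneg (by linarith) (mul_nonneg (sq_nonneg _) (by linarith))
        rcases eq_or_lt_of_le hC1 with hCeq | hClt
        · subst hCeq; nlinarith
        · have hpos : 0 < 1 - C := by linarith
          have : 0 ≤ (1 - C) * ((1 - C) * lam * A - ((1 + lam) * C - 1) * (A - C)) := by rw [e]; linarith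
          have := (mul_nonneg_iff_of_pos_left hpos).mp this
          linarith
      nlinarith [mul_le_mul_of_nonneg_left g3 hc0]
    have h1 : s * a * (1 - c) * mt * (A - C) ≤ a * mt * ((1 - c) * (A - C)) := by
      have : 0 ≤ a * mt * ((1 - c) * (A - C)) := by
        have : 0 ≤ (1 - c) * (A - C) := mul_nonneg (by linarith) (by linarith)
        positivity
      nlinarith
    have h2 : a * mt * ((1 - c) * (A - C)) ≤ a * mt * ((1 - C) * lam * A * c) :=
      mul_le_mul_of_nonneg_left hcore (by positivity)
    have h3 : a * mt * ((1 - C) * lam * A * c) = (1 - C) * lam * A * (a * c * mt) := by ring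
    have h4 : (1 - C) * lam * A * (a * c * mt) ≤ (1 - C) * lam * A * q :=
      mul_le_mul_of_nonneg_left hq (by have : 0 ≤ 1 - C := by linarith
                                       positivity)
    linarith

/-- **(♣) un-normalised** (PROOF-RCG3 §3(b)): from `k3_diamond_un` by `A ≤ 1`, `s ≤ 1`, `A − C ≤ 1 − C`, `P_F ≤ 1`, `C ≤ M₁`:
`(1−λ)λ·A·c·a·v_F·p·P_F + s·a²·ν·λ′₂·X·P_F + s·λ(A−C)·c·a²·σ·v_F·P_F² ≤ c·v_F·p·(¾ + M₁·a·ν)`.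
[cite: KozmaNitzan2024, Question 8 (§5.5 p. 36)] -/
theorem k3_club_un (lam A C s a c sig uF vF mF M₁ : ℝ) (hl0 : 0 < lam) (hl1 : lam < 1) (hA1 : A ≤ 1)
    (ha0 : 0 ≤ a) (ha1 : a ≤ 1) (hc0 : 0 < c) (hc1 : c ≤ 1) (hC1 : C ≤ 1) (hCM : C ≤ M₁) (hW : 1 ≤ (1 + lam) * C * c)
    (hs0 : 0 ≤ s) (hs1 : s ≤ 1) (hsig0 : 0 ≤ sig) (hsig1 : sig ≤ 1)
    (hu : 0 ≤ uF) (hv : 0 ≤ vF) (hm : 0 ≤ mF) (hPF : 0 < uF + vF + mF) (hPF1 : uF + vF + mF ≤ 1)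
    (hcross : ((1 + lam) * C * c - 1) * mF ≤ vF) :
    (1 - lam) * lam * A * c * a * vF * (c * ((uF + vF + mF) - sig * vF) + a * ((1 - c) * ((uF + vF + mF) - sig * uF) + c * sig * vF)) * (uF + vF + mF)
        + s * a ^ 2 * ((1 - c) * ((uF + vF + mF) - sig * uF) + c * sig * vF) * ((1 + lam) * C * c - 1) * (vF + mF) * (uF + vF + mF)
        + s * lam * (A - C) * c * a ^ 2 * sig * vF * (uF + vF + mF) ^ 2
      ≤ c * vF * (c * ((uF + vF + mF) - sig * vF) + a * ((1 - c) * ((uF + vF + mF) - sig * uF) + c * sig * vF)) * (3 / 4 + M₁ * a * ((1 - c) * ((uF + vF + mF) - sig * uF) + c * sig * vF)) := by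
  have hCpos : 0 < C := by
    by_contra hh
    push Not at hh
    have hp : 0 < (1 + lam) * c := by positivity
    have e : (1 + lam) * C * c = C * ((1 + lam) * c) := by ring
    nlinarith [mul_nonpos_of_nonpos_of_nonneg hh hp.le]
  have hsu : 0 ≤ (uF + vF + mF) - sig * uF := by
    have : sig * uF ≤ 1 * uF := mul_le_mul_of_nonneg_right hsig1 hu
    linarith
  have hsv : 0 ≤ (uF + vF + mF) - sig * vF := by
    have : sig * vF ≤ 1 * vF := mul_le_mul_of_nonneg_right hsig1 hv
    linarith
  have hNU : 0 ≤ ((1 - c) * ((uF + vF + mF) - sig * uF) + c * sig * vF) := by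
    have : 0 ≤ (1 - c) * ((uF + vF + mF) - sig * uF) := mul_nonneg (by linarith) hsu
    have : 0 ≤ c * sig * vF := by positivity
    linarith
  have hPP : 0 ≤ (c * ((uF + vF + mF) - sig * vF) + a * ((1 - c) * ((uF + vF + mF) - sig * uF) + c * sig * vF)) := by
    have : 0 ≤ c * ((uF + vF + mF) - sig * vF) := mul_nonneg hc0.le hsv
    have : 0 ≤ a * ((1 - c) * ((uF + vF + mF) - sig * uF) + c * sig * vF) := mul_nonneg ha0 hNU
    linarith
  have hl2 : 0 ≤ (1 + lam) * C * c - 1 := by linarith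
  -- term by term
  have base1 : 0 ≤ lam * c * a * vF * (c * ((uF + vF + mF) - sig * vF) + a * ((1 - c) * ((uF + vF + mF) - sig * uF) + c * sig * vF)) * (uF + vF + mF) := by
    have : 0 ≤ lam * c * a * vF := by positivity
    exact mul_nonneg (mul_nonneg this hPP) hPF.le
  have t1 : (1 - lam) * lam * A * c * a * vF * (c * ((uF + vF + mF) - sig * vF) + a * ((1 - c) * ((uF + vF + mF) - sig * uF) + c * sig * vF)) * (uF + vF + mF) ≤ (1 - lam) * lam * c * a * vF * (c * ((uF + vF + mF) - sig * vF) + a * ((1 - c) * ((uF + vF + mF) - sig * uF) + c * sig * vF)) * (uF + vF + mF) := by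
    have e : (1 - lam) * lam * A * c * a * vF * (c * ((uF + vF + mF) - sig * vF) + a * ((1 - c) * ((uF + vF + mF) - sig * uF) + c * sig * vF)) * (uF + vF + mF) = A * ((1 - lam) * (lam * c * a * vF * (c * ((uF + vF + mF) - sig * vF) + a * ((1 - c) * ((uF + vF + mF) - sig * uF) + c * sig * vF)) * (uF + vF + mF))) := by ring
    have e2 : (1 - lam) * lam * c * a * vF * (c * ((uF + vF + mF) - sig * vF) + a * ((1 - c) * ((uF + vF + mF) - sig * uF) + c * sig * vF)) * (uF + vF + mF) = 1 * ((1 - lam) * (lam * c * a * vF * (c * ((uF + vF + mF) - sig * vF) + a * ((1 - c) * ((uF + vF + mF) - sig * uF) + c * sig * vF)) * (uF + vF + mF))) := by ring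
    rw [e, e2]
    exact mul_le_mul_of_nonneg_right hA1 (mul_nonneg (by linarith) base1)
  have base2 : 0 ≤ a ^ 2 * ((1 - c) * ((uF + vF + mF) - sig * uF) + c * sig * vF) * ((1 + lam) * C * c - 1) * (vF + mF) * (uF + vF + mF) := by
    have : 0 ≤ a ^ 2 * ((1 - c) * ((uF + vF + mF) - sig * uF) + c * sig * vF) := mul_nonneg (sq_nonneg a) hNU
    exact mul_nonneg (mul_nonneg (mul_nonneg this hl2) (by linarith)) hPF.le
  have t2 : s * a ^ 2 * ((1 - c) * ((uF + vF + mF) - sig * uF) + c * sig * vF) * ((1 + lam) * C * c - 1) * (vF + mF) * (uF + vF + mF)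
      ≤ a ^ 2 * ((1 - c) * ((uF + vF + mF) - sig * uF) + c * sig * vF) * ((1 + lam) * C * c - 1) * (vF + mF) * (uF + vF + mF) := by
    have e : s * a ^ 2 * ((1 - c) * ((uF + vF + mF) - sig * uF) + c * sig * vF) * ((1 + lam) * C * c - 1) * (vF + mF) * (uF + vF + mF) = s * (a ^ 2 * ((1 - c) * ((uF + vF + mF) - sig * uF) + c * sig * vF) * ((1 + lam) * C * c - 1) * (vF + mF) * (uF + vF + mF)) := by ring
    rw [e]
    have := mul_le_mul_of_nonneg_right hs1 base2
    linarith
  have base3 : 0 ≤ lam * c * a ^ 2 * sig * vF * (uF + vF + mF) ^ 2 := by positivity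
  have t3 : s * lam * (A - C) * c * a ^ 2 * sig * vF * (uF + vF + mF) ^ 2 ≤ lam * (1 - C) * c * a ^ 2 * sig * vF * (uF + vF + mF) ^ 2 := by
    have hsAC : s * (A - C) ≤ 1 - C := by
      rcases le_or_gt 0 (A - C) with hAC | hAC
      · have : s * (A - C) ≤ 1 * (A - C) := mul_le_mul_of_nonneg_right hs1 hAC
        linarith
      · have : s * (A - C) ≤ 0 := mul_nonpos_of_nonneg_of_nonpos hs0 hAC.le
        linarith
    have e1 : s * lam * (A - C) * c * a ^ 2 * sig * vF * (uF + vF + mF) ^ 2 = (s * (A - C)) * (lam * c * a ^ 2 * sig * vF * (uF + vF + mF) ^ 2) := by ring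
    have e2 : lam * (1 - C) * c * a ^ 2 * sig * vF * (uF + vF + mF) ^ 2 = (1 - C) * (lam * c * a ^ 2 * sig * vF * (uF + vF + mF) ^ 2) := by ring
    rw [e1, e2]; exact mul_le_mul_of_nonneg_right hsAC base3
  -- right side: ¾·P_F ≤ ¾ and C ≤ M₁
  have base4 : 0 ≤ c * vF * (c * ((uF + vF + mF) - sig * vF) + a * ((1 - c) * ((uF + vF + mF) - sig * uF) + c * sig * vF)) := mul_nonneg (mul_nonneg hc0.le hv) hPP
  have r1 : c * vF * (c * ((uF + vF + mF) - sig * vF) + a * ((1 - c) * ((uF + vF + mF) - sig * uF) + c * sig * vF)) * (3 / 4 * (uF + vF + mF)) ≤ c * vF * (c * ((uF + vF + mF) - sig * vF) + a * ((1 - c) * ((uF + vF + mF) - sig * uF) + c * sig * vF)) * (3 / 4) := by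
    apply mul_le_mul_of_nonneg_left _ base4; linarith
  have r2 : c * vF * (c * ((uF + vF + mF) - sig * vF) + a * ((1 - c) * ((uF + vF + mF) - sig * uF) + c * sig * vF)) * (C * a * ((1 - c) * ((uF + vF + mF) - sig * uF) + c * sig * vF)) ≤ c * vF * (c * ((uF + vF + mF) - sig * vF) + a * ((1 - c) * ((uF + vF + mF) - sig * uF) + c * sig * vF)) * (M₁ * a * ((1 - c) * ((uF + vF + mF) - sig * uF) + c * sig * vF)) := by
    apply mul_le_mul_of_nonneg_left _ base4
    exact mul_le_mul_of_nonneg_right (mul_le_mul_of_nonneg_right hCM ha0) hNU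
  -- expand h and combine
  have h := k3_diamond_un lam a c C sig uF vF mF hl0 hl1 ha0 ha1 hc0 hc1 hC1 hW hsig0 hsig1 hu hv hm hPF hcross
  have hexp : a ^ 2 * (uF + vF + mF) * (((1 - c) * ((uF + vF + mF) - sig * uF) + c * sig * vF) * ((1 + lam) * C * c - 1) * (vF + mF) + lam * (1 - C) * c * sig * vF * (uF + vF + mF))
      = a ^ 2 * ((1 - c) * ((uF + vF + mF) - sig * uF) + c * sig * vF) * ((1 + lam) * C * c - 1) * (vF + mF) * (uF + vF + mF) + lam * (1 - C) * c * a ^ 2 * sig * vF * (uF + vF + mF) ^ 2 := by ring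
  have hexp2 : c * vF * (c * ((uF + vF + mF) - sig * vF) + a * ((1 - c) * ((uF + vF + mF) - sig * uF) + c * sig * vF)) * ((3 / 4 - lam * (1 - lam) * a) * (uF + vF + mF) + C * a * ((1 - c) * ((uF + vF + mF) - sig * uF) + c * sig * vF))
      = c * vF * (c * ((uF + vF + mF) - sig * vF) + a * ((1 - c) * ((uF + vF + mF) - sig * uF) + c * sig * vF)) * (3 / 4 * (uF + vF + mF)) - (1 - lam) * lam * c * a * vF * (c * ((uF + vF + mF) - sig * vF) + a * ((1 - c) * ((uF + vF + mF) - sig * uF) + c * sig * vF)) * (uF + vF + mF) + c * vF * (c * ((uF + vF + mF) - sig * vF) + a * ((1 - c) * ((uF + vF + mF) - sig * uF) + c * sig * vF)) * (C * a * ((1 - c) * ((uF + vF + mF) - sig * uF) + c * sig * vF)) := by ring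
  have hexp3 : c * vF * (c * ((uF + vF + mF) - sig * vF) + a * ((1 - c) * ((uF + vF + mF) - sig * uF) + c * sig * vF)) * (3 / 4 + M₁ * a * ((1 - c) * ((uF + vF + mF) - sig * uF) + c * sig * vF)) = c * vF * (c * ((uF + vF + mF) - sig * vF) + a * ((1 - c) * ((uF + vF + mF) - sig * uF) + c * sig * vF)) * (3 / 4) + c * vF * (c * ((uF + vF + mF) - sig * vF) + a * ((1 - c) * ((uF + vF + mF) - sig * uF) + c * sig * vF)) * (M₁ * a * ((1 - c) * ((uF + vF + mF) - sig * uF) + c * sig * vF)) := by ring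
  rw [hexp, hexp2] at h
  rw [hexp3]
  linarith [t1, t2, t3, r1, r2, h]

end PocketCert

end Summit.CriticalPhenomena.PercolationContinuityZ3.Theorems
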